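import Literature.RepresentationTheory.AugmentationModuleVerySimpleCases
import Mathlib.FieldTheory.Finite.Basic
import Mathlib.GroupTheory.Perm.ViaEmbedding
import Mathlib.GroupTheory.Abelianization.Defs
import HarnessLib

/-!
# Zarhin's very-simplicity criterion for perfect groups (Zarhin 2002, Theorem 4.3)

Topic `Literature/RepresentationTheory`, namespace `Literature.RepresentationTheory`; lane `lit-hodgefound`
(Track 2 foundations library), row g10-#2 «Q1110⁺ · (g10-#1)⁺ — Zarhin 2002 THEOREM 4.3 AS PRINTED (the
very-simplicity criterion for PERFECT groups) with the centre step of Dolgachev–Zarhin's proof of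
Theorem 2.21 AS PRINTED ("`𝔄_n` perfect, `Aut(F) = Gal(F/𝔽_ℓ)` abelian")» of seat p11 (gen 10). Sequel of
`VerySimpleCriterion.lean` (Q1110: Steps 3–4 for a finite SIMPLE group with the order count
`dim V < |G|` replacing perfectness — a recorded deviation) and `AugmentationModuleVerySimpleCases.lean`
(g10-#1: Step 4 in its printed form). THEOREMS ONLY (no definition, no named fact; net debt 0).

## Sources READ (held texts), verbatim

Yu. G. Zarhin, *Very simple 2-adic representations and hyperelliptic Jacobians*, Mosc. Math. J. 2
(2002) 403–431 (bib `Zarhin2002VerySimple`; held text `paper:arxiv-math_0109014`), §4, p0011 L26–L44: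
"The following assertion is a special case of Th. 4.3 of [ZarhinCrelle]. **Theorem 4.3.** Suppose a
finite field field `k`, a positive integer `N` and a group `H` enjoy the following properties: • `H` is
perfect, i.e., `H = [H, H]`; • Each homomorphism from `H` to `𝐒_N` is trivial; • Let `N = ab` be a
factorization of `N` into a product of two positive integers `a` and `b`. Then either each homomorphism
from `H` to `PGL_a(k)` is trivial or each homomorphism from `H` to `PGL_b(F)` is trivial. Then each
absolutely simple `H`-module of `k`-dimension `N` is very simple. In other words, in dimension `N` the
properties of absolute simplicity and very simplicity over `F` are equivalent." (Definition 4.1, p0010: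
very simple modules = the tree's `IsVerySimple`; Remarks 4.2 (ii): "a very simple module is absolutely
simple" = the tree's `IsVerySimple.asAlgebraHom_surjective`.)

I. Dolgachev, Yu. G. Zarhin, *Endomorphisms of Complex Abelian Varieties* (2024; bib `DolgachevZarhin2024`;
held text `paper:galaxy-pdf-8712177384607648460`), §2.3, proof of Theorem 2.21 — the ARGUMENT, which is
written for `H = 𝔄_n` but uses exactly the three hypotheses of Theorem 4.3: Steps 1–2 (p0039 L17–p0040 L8;
"This gives rise to the homomorphism `G → 𝐒_r`. […] this homomorphism must be trivial"), **Step 3**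
(p0040 L9–p0041 L9): "`F = End_R(W)`. Since `W` is simple, `F` is a finite division algebra of
characteristic `ℓ`. Therefore `F` is a finite field […] Since `F` is the center of `Mat_d(F)`, it is
stable under the action of `𝔄_n`, i.e., we get a homomorphism `𝔄_n → Aut(F)`, which must be trivial,
since `𝔄_n` is a simple non-abelian group, and `Aut(F) = Gal(F/𝔽_ℓ)` is abelian. This implies that the
center `F` of `End_R(𝒱)` commutes with `𝔄_n`. Since `End_G(𝒱) = 𝔽_ℓ` (recall that the `𝔄_n`-module `𝒱`
is absolutely simple), we have `k = 𝔽_ℓ`. […] This implies that we are done if either `α`, or `β` is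
trivial", Step 4 (p0041 L11: "Recall that `md = n − 1`"), and Case (vi) (p0043 L11: "Since `𝔄_5` is simple
perfect").

## What is proved

* §1 perfect groups: a homomorphism from a perfect group (`commutator G = ⊤`) to a commutative group is
  trivial (`monoidHom_eq_one_of_commutator_eq_top`); "**`𝔄_n` is a simple non-abelian group**", hence
  perfect: a non-commutative simple group is perfect (`commutator_eq_top_of_isSimpleGroup`), `Alt(X)` is
  perfect for `|X| ≥ 5` (`commutator_alternatingGroup_eq_top`, Mathlib `alternatingGroup.isSimpleGroup`
  and `alternatingGroup.isMulCommutative_iff_card_le_three`).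
* §2 "Each homomorphism from `H` to `𝐒_N` is trivial" ⇒ the same for `𝐒_r`, `r ≤ N` (`𝐒_r ↪ 𝐒_N`;
  `perm_hom_eq_one_of_le`) — the form Step 2 consumes.
* §3 **the centre step as printed**: for a perfect `G`, a normal `R` with `End_R(V)` a simple ring and
  `End_G(V) = k·Id` over a FINITE field `k`, the centre `Z` of `End_R(V)` is `k·Id` — `Z` is a finite
  field, `Aut_k(Z)` is cyclic (Mathlib's instance `IsCyclic Gal(L/K)` for finite `L`: "`Aut(F) =
  Gal(F/𝔽_ℓ)` is abelian"), so `G → Aut_k(Z)` is trivial and `Z ⊆ End_G(V) = k`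
  (`IsNormalSubalgebra.center_end_eq_bot_of_commutator_eq_top`).
* §4 **Theorem 4.3** (`isVerySimple_of_commutator_eq_top`): `k` a finite field, `V` a finite-dimensional
  `G`-module which is absolutely simple in the form the proof uses (irreducible with `End_G(V) = k·Id`,
  as in Q1110), `G` perfect, every `G → 𝐒_N` trivial (`N = dim_k V`), and for every factorisation
  `N = ab` every `G → PGL_a(k)` trivial or every `G → PGL_b(k)` trivial, where `PGL_c(k)` is rendered as
  `Aut_{k-alg}(Mat_c(k))` (`= GL_c(k)/k^*` by Skolem–Noether; g10-#1's `natCard_algEquiv_matrix_mul`)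
  ⇒ `V` is very simple. The `min(d, m)`-form of g10-#1 (every `G → PGL_c(k)` trivial for `1 < c`,
  `c ∣ N`, `c² ≤ N`) implies the factorisation hypothesis (`isVerySimple_of_commutator_eq_top'`).

Not here (recorded): the converse clause "In other words …" is Remarks 4.2 (ii) (the tree's
`IsVerySimple.asAlgebraHom_surjective`); Th. 4.3 of [ZarhinCrelle] in its general form.

## References

* [Zarhin2002VerySimple] Yu. G. Zarhin, *Very simple 2-adic representations and hyperelliptic
  Jacobians*, Mosc. Math. J. 2 (2002) 403–431, §4 Theorem 4.3 (held text p0011 L26–L44), Definition 4.1,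
  Remarks 4.2.
* [DolgachevZarhin2024] I. Dolgachev, Yu. G. Zarhin, *Endomorphisms of Complex Abelian Varieties* (2024),
  §2.3 proof of Theorem 2.21, Steps 1–4 (held text p0039 L13–p0041 L16), Case (vi) (p0043 L11).
-/

namespace Literature.RepresentationTheory

open Module

/-! ## §1 Perfect groups; "`𝔄_n` is a simple non-abelian group" -/

section Perfect

variable {G : Type*} [Group G]

/-- **"`H` is perfect, i.e., `H = [H, H]`" ⇒ every homomorphism to an abelian group is trivial** (its
kernel contains all commutators). [cite: Zarhin2002VerySimple, §4 Theorem 4.3 (hypothesis (a))]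
[cite: DolgachevZarhin2024, §2.3 proof of Theorem 2.21, Step 3] -/
theorem monoidHom_eq_one_of_commutator_eq_top {H : Type*} [Group H] [IsMulCommutative H]
    (hG : commutator G = ⊤) (f : G →* H) : f = 1 := by
  have hker : commutator G ≤ f.ker := by
    rw [commutator_eq_closure, Subgroup.closure_le]
    rintro x ⟨p, q, rfl⟩
    rw [SetLike.mem_coe, MonoidHom.mem_ker, commutatorElement_def, map_mul, map_mul, map_mul,
      map_inv, map_inv, IsMulCommutative.is_comm.comm (f p) (f q), mul_inv_cancel_right,
      mul_inv_cancel]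
  ext g
  have : g ∈ f.ker := hker (hG ▸ Subgroup.mem_top g)
  simpa using this

/-- **"since `𝔄_n` is a simple non-abelian group"**: a non-commutative simple group is perfect (its
commutator subgroup is normal and non-trivial). [cite: DolgachevZarhin2024, §2.3 proof of Theorem 2.21, Step 3] -/
theorem commutator_eq_top_of_isSimpleGroup [IsSimpleGroup G] (hG : ¬ IsMulCommutative G) :
    commutator G = ⊤ := by
  rcases (inferInstance : (commutator G).Normal).eq_bot_or_eq_top with h | h
  · exact absurd ((commutator_eq_bot_iff G).1 h) hG
  · exact h

/-- **"`𝔄_5` is simple perfect"** — `Alt(X)` is perfect for `|X| ≥ 5` (simple, and non-commutative as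
`|X| > 3`). [cite: DolgachevZarhin2024, §2.3 proof of Theorem 2.21, Step 3 and Case (vi)] -/
theorem commutator_alternatingGroup_eq_top {X : Type*} [Fintype X] [DecidableEq X]
    (h5 : 5 ≤ Fintype.card X) : commutator (alternatingGroup X) = ⊤ := by
  have hcard : 5 ≤ Nat.card X := by rwa [Nat.card_eq_fintype_card]
  haveI : IsSimpleGroup (alternatingGroup X) := alternatingGroup.isSimpleGroup hcard
  refine commutator_eq_top_of_isSimpleGroup fun hc ↦ ?_
  have := alternatingGroup.isMulCommutative_iff_card_le_three.1 hc
  omega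

end Perfect

/-! ## §2 "Each homomorphism from `H` to `𝐒_N` is trivial" ⇒ the same for `𝐒_r`, `r ≤ N` -/

section Perm

variable {G : Type*} [Group G]

/-- If every `G → 𝐒_N` is trivial then every `G → 𝐒_r`, `r ≤ N`, is trivial (`𝐒_r ↪ 𝐒_N` along
`Fin r ↪ Fin N`). [cite: Zarhin2002VerySimple, §4 Theorem 4.3 (hypothesis (b))]
[cite: DolgachevZarhin2024, §2.3 proof of Theorem 2.21, Step 2] -/
theorem perm_hom_eq_one_of_le {N : ℕ} (hN : ∀ f : G →* Equiv.Perm (Fin N), f = 1) {r : ℕ}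
    (hr : r ≤ N) (f : G →* Equiv.Perm (Fin r)) : f = 1 := by
  have h := hN ((Equiv.Perm.viaEmbeddingHom (Fin.castLEEmb hr)).comp f)
  ext g : 1
  apply Equiv.Perm.viaEmbeddingHom_injective (Fin.castLEEmb hr)
  have hg := DFunLike.congr_fun h g
  rw [MonoidHom.comp_apply, MonoidHom.one_apply] at hg
  rw [hg, MonoidHom.one_apply, map_one]

end Perm

/-! ## §3 The centre step as printed: `G` perfect, `Aut(F) = Gal(F/𝔽_ℓ)` abelian -/

section Center

variable {k : Type*} [Field k] {A : Type*} [Ring A] [Algebra k A]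

/-- The centre of a simple ring is a field (Mathlib `IsSimpleRing.isField_center`, transported from
`Subring.center` to `Subalgebra.center`; a private copy of Q1110's helper). [folklore] -/
private theorem isField_center_of_isSimpleRing' [IsSimpleRing A] : IsField (Subalgebra.center k A) := by
  have hF := IsSimpleRing.isField_center A
  refine ⟨?_, fun a b ↦ ?_, fun {a} ha ↦ ?_⟩
  · obtain ⟨x, y, hxy⟩ := hF.exists_pair_ne
    refine ⟨⟨x.1, Subalgebra.mem_center_iff.2 (Subring.mem_center_iff.1 x.2)⟩,
      ⟨y.1, Subalgebra.mem_center_iff.2 (Subring.mem_center_iff.1 y.2)⟩, fun h ↦ hxy (Subtype.ext ?_)⟩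
    exact congrArg Subtype.val h
  · exact Subtype.ext ((Subalgebra.mem_center_iff.1 a.2) b).symm
  · have ha' : (⟨a.1, Subring.mem_center_iff.2 (Subalgebra.mem_center_iff.1 a.2)⟩ :
        Subring.center A) ≠ 0 :=
      fun h ↦ ha (Subtype.ext (congrArg Subtype.val h))
    obtain ⟨b, hb⟩ := hF.mul_inv_cancel ha'
    exact ⟨⟨b.1, Subalgebra.mem_center_iff.2 (Subring.mem_center_iff.1 b.2)⟩,
      Subtype.ext (congrArg Subtype.val hb)⟩

variable {V : Type*} [AddCommGroup V] [Module k V] [Module A V] [IsScalarTower k A V]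

/-- `End_A(V)` is finite-dimensional over `k` when `V` is (it embeds in `End_k(V)`). [folklore] -/
private theorem finite_end_of_finiteDimensional' [FiniteDimensional k V] :
    Module.Finite k (Module.End A V) :=
  Module.Finite.of_injective
    ((LinearMap.restrictScalarsₗ k A V V k) : Module.End A V →ₗ[k] Module.End k V)
    (LinearMap.restrictScalars_injective k)

end Center

namespace IsNormalSubalgebra

variable {k : Type*} [Field k] {G : Type*} [Group G] {V : Type*} [AddCommGroup V] [Module k V]
variable {ρ : Representation k G V} {R : Subalgebra k (Module.End k V)}

/-- **The centre step, as printed.** For a perfect `G`, a `G`-normal `R ⊂ End_k(V)` over a FINITE field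
`k` with `End_R(V)` a simple ring and `End_G(V) = k·Id`, the centre `Z` of `End_R(V)` is `k·Id`: "`F`
is a finite field […] we get a homomorphism `𝔄_n → Aut(F)`, which must be trivial, since `𝔄_n` is
[perfect], and `Aut(F) = Gal(F/𝔽_ℓ)` is abelian. This implies that the center `F` of `End_R(𝒱)`
commutes with `𝔄_n`. Since `End_G(𝒱) = 𝔽_ℓ` […] we have `k = 𝔽_ℓ`." (Mathlib: the Galois group of a
finite field is cyclic.) [cite: DolgachevZarhin2024, §2.3 proof of Theorem 2.21, Step 3]
[cite: Zarhin2002VerySimple, §4 Theorem 4.3] -/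
theorem center_end_eq_bot_of_commutator_eq_top [Finite k] [FiniteDimensional k V] [Nontrivial V]
    (h : IsNormalSubalgebra ρ R)
    (hcomm : Subalgebra.centralizer k (Set.range (ρ : G → Module.End k V)) = ⊥)
    (hsimple : IsSimpleRing (Module.End R V)) (hperf : commutator G = ⊤) :
    Subalgebra.center k (Module.End R V) = ⊥ := by
  haveI := hsimple
  haveI := finite_end_of_finiteDimensional' (k := k) (A := R) (V := V)
  have hF : IsField (Subalgebra.center k (Module.End R V)) := isField_center_of_isSimpleRing'
  haveI : FiniteDimensional k (Subalgebra.center k (Module.End R V)) :=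
    Module.Finite.of_injective (Subalgebra.center k (Module.End R V)).val.toLinearMap
      Subtype.val_injective
  -- "`F` is a finite field", so `Aut_k(F)` is cyclic, in particular commutative
  haveI : Finite (Subalgebra.center k (Module.End R V)) := Module.finite_of_finite k
  letI : Field (Subalgebra.center k (Module.End R V)) := hF.toField
  -- `G → Aut_k(Z)` is trivial: `G` is perfect and the target is abelian
  have htriv : (centerCongrHom.comp h.conjEndHom : G →* _) = 1 :=
    monoidHom_eq_one_of_commutator_eq_top hperf _
  refine le_antisymm (fun z hz ↦ ?_) bot_le
  -- `z` is fixed by every `ρ(s) · ρ(s)⁻¹`, hence a scalar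
  obtain ⟨c, hc⟩ := h.exists_eq_smul_one_of_forall_conjEnd_eq hcomm (f := z) fun s ↦ by
    have h1 := DFunLike.congr_fun htriv s
    have h2 := AlgEquiv.congr_fun h1 ⟨z, hz⟩
    have h3 := congrArg Subtype.val h2
    simpa using h3
  rw [hc]
  exact Subalgebra.smul_mem _ (Subalgebra.one_mem _) c

end IsNormalSubalgebra

/-! ## §4 Theorem 4.3 -/

section Main

variable {k : Type*} [Field k] {G : Type*} [Group G] {V : Type*} [AddCommGroup V] [Module k V]
variable {ρ : Representation k G V}

/-- An irreducible representation lives on a non-zero space. [folklore] -/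
private theorem nontrivial_of_isIrreducible''' [ρ.IsIrreducible] : Nontrivial V := by
  have hne : (⊥ : Subrepresentation ρ) ≠ ⊤ := bot_ne_top
  have hne' : (⊥ : Submodule k V) ≠ ⊤ := fun e ↦ hne (Subrepresentation.toSubmodule_injective e)
  exact (Submodule.nontrivial_iff k).mp (nontrivial_of_ne _ _ hne')

/-- **Zarhin's criterion (Theorem 4.3).** Let `k` be a finite field and `V` a finite-dimensional
`G`-module of dimension `N` which is absolutely simple (irreducible with `End_G(V) = k·Id`). Suppose that
(a) `G` is perfect, (b) every homomorphism `G → 𝐒_N` is trivial, and (c) for every factorisation `N = ab`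
either every homomorphism `G → PGL_a(k)` is trivial or every homomorphism `G → PGL_b(k)` is trivial
(`PGL_c(k) = Aut_{k-alg}(Mat_c(k))`). Then `V` is very simple. Proof (Dolgachev–Zarhin's Steps 1–4): a
normal `R` makes `V ≅ W^d` isotypic by (b) (Steps 1–2), the centre of `End_R(V) ≅ Mat_d(F)` is `k` by
(a) (Step 3, `center_end_eq_bot_of_commutator_eq_top`), so `End_R(V) ≅ Mat_d(k)` and `R ≅ Mat_m(k)`
with `dm = N`; by (c) for `N = dm` the adjoint action `α : G → Aut(Mat_d(k))` is trivial — then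
`R = End(V)` — or `β : G → Aut(Mat_m(k))` is — then `R = k·Id` (Step 4).
[cite: Zarhin2002VerySimple, §4 Theorem 4.3] [cite: DolgachevZarhin2024, §2.3 proof of Theorem 2.21, Steps 1–4] -/
theorem isVerySimple_of_commutator_eq_top [Finite k] [FiniteDimensional k V] [ρ.IsIrreducible]
    (hcomm : Subalgebra.centralizer k (Set.range (ρ : G → Module.End k V)) = ⊥)
    (hperf : commutator G = ⊤)
    (hperm : ∀ f : G →* Equiv.Perm (Fin (finrank k V)), f = 1)
    (hPGL : ∀ a b : ℕ, a * b = finrank k V →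
      (∀ f : G →* (Matrix (Fin a) (Fin a) k ≃ₐ[k] Matrix (Fin a) (Fin a) k), f = 1) ∨
      (∀ f : G →* (Matrix (Fin b) (Fin b) k ≃ₐ[k] Matrix (Fin b) (Fin b) k), f = 1)) :
    IsVerySimple ρ := by
  haveI : Nontrivial V := nontrivial_of_isIrreducible''' (ρ := ρ)
  refine ⟨inferInstance, fun R hR ↦ ?_⟩
  -- Steps 1–2: `V` is a semisimple isotypic `R`-module
  haveI : IsSemisimpleModule R V := hR.isSemisimpleModule_of_isIrreducible
  have hiso : IsIsotypic R V :=
    hR.isIsotypic_of_forall_perm_hom_eq_one fun r hr f ↦ perm_hom_eq_one_of_le hperm hr f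
  haveI : Module.Finite R V := Module.Finite.of_restrictScalars_finite k R V
  obtain ⟨d, hd, S, hS, ⟨e⟩⟩ := hiso.linearEquiv_fun
  haveI : Module.Finite k S :=
    Module.Finite.of_injective (S.subtype.restrictScalars k) Subtype.val_injective
  haveI : Nontrivial S := IsSimpleModule.nontrivial R S
  -- Step 3: the centre of the simple ring `End_R(V)` is `k` (perfectness), hence `F = End_R(W) = k`
  have hZ : Subalgebra.center k (Module.End R V) = ⊥ :=
    hR.center_end_eq_bot_of_commutator_eq_top hcomm (isSimpleRing_end (k := k) (W := S) e) hperf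
  have hE := exists_end_eq_smul_of_center_eq_bot (k := k) (A := R) (W := S) e
    (end_mul_comm (k := k) (A := R) (W := S)) hZ
  -- `dm = N`
  have hdm : finrank k V = d * finrank k S := finrank_eq_mul (k := k) (W := S) e
  -- Step 4: hypothesis (c) for the factorisation `N = d · m`
  rcases hPGL d (finrank k S) hdm.symm with hα | hβ
  · -- every `G → PGL_d(k)` is trivial: `α` is trivial, so `R = End(V)`
    right
    exact hR.eq_top_of_conjEndHom_eq_one hcomm
      (monoidHom_algEquiv_eq_one_of_algEquiv_matrix (endAlgEquivMatrixField (k := k) (W := S) e hE)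
        (Or.inr hα) _)
  · -- every `G → PGL_m(k)` is trivial: `β` is trivial, so `R = k·Id`
    left
    exact hR.eq_bot_of_conjSubHom_eq_one hcomm
      (monoidHom_algEquiv_eq_one_of_algEquiv_matrix (algEquivMatrixField (k := k) (W := S) e hE)
        (Or.inr hβ) _)

/-- **Theorem 4.3 with hypothesis (c) in Dolgachev–Zarhin's `c = min(d, m)` form**: it suffices that
every `G → PGL_c(k)` be trivial for every `c` with `1 < c`, `c ∣ N`, `c² ≤ N` (for `N = ab` the smaller
factor is such a `c`, or equals `1`, and `PGL_1(k) = 1`).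
[cite: Zarhin2002VerySimple, §4 Theorem 4.3] [cite: DolgachevZarhin2024, §2.3 proof of Theorem 2.21, Step 4] -/
theorem isVerySimple_of_commutator_eq_top' [Finite k] [FiniteDimensional k V] [ρ.IsIrreducible]
    (hcomm : Subalgebra.centralizer k (Set.range (ρ : G → Module.End k V)) = ⊥)
    (hperf : commutator G = ⊤)
    (hperm : ∀ f : G →* Equiv.Perm (Fin (finrank k V)), f = 1)
    (hAut : ∀ c : ℕ, 1 < c → c ∣ finrank k V → c * c ≤ finrank k V →
      ∀ f : G →* (Matrix (Fin c) (Fin c) k ≃ₐ[k] Matrix (Fin c) (Fin c) k), f = 1) :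
    IsVerySimple ρ := by
  refine isVerySimple_of_commutator_eq_top hcomm hperf hperm fun a b hab ↦ ?_
  -- the smaller factor `c = min(a, b)` has `c ∣ N`, `c² ≤ N`; if `c = 1`, `PGL_1 = 1`
  rcases le_total a b with hle | hle
  · left
    rcases Nat.lt_or_ge 1 a with h1 | h1
    · exact hAut a h1 ⟨b, hab.symm⟩ (hab ▸ Nat.mul_le_mul_left a hle)
    · intro f
      interval_cases a
      · -- `a = 0`: then `N = 0`, contradicting `V ≠ 0`
        haveI : Nontrivial V := nontrivial_of_isIrreducible''' (ρ := ρ)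
        have : 0 < finrank k V := finrank_pos
        omega
      · exact monoidHom_algEquiv_matrix_fin_one_eq_one f
  · right
    rcases Nat.lt_or_ge 1 b with h1 | h1
    · exact hAut b h1 ⟨a, by rw [← hab, mul_comm]⟩ (hab ▸ Nat.mul_le_mul_right b hle)
    · intro f
      interval_cases b
      · haveI : Nontrivial V := nontrivial_of_isIrreducible''' (ρ := ρ)
        have : 0 < finrank k V := finrank_pos
        omega
      · exact monoidHom_algEquiv_matrix_fin_one_eq_one f

end Main

end Literature.RepresentationTheory
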